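import Mathlib
import Summits.NavierStokesRegularity.NavierStokesRegularity.Theorems.EulerZoomLiouvillePowerGaugeEulerLiouvilleSmallMomentBounds
import HarnessLib

/-!
# t57-F1, step 2: THE TWO BUDGET BOUNDS FOR A DILATED VORTICITY MOMENT (any `C¹_c` weight, any order `q ∈ (0,1]`)
# (nsreg-p2 ROUND-53 «THE FLOOR» v1.0, `r53/Sketch53.lean` 8300150c723efd46 §A (F1); key 07:12:23Z; seat ns-sfl-p1 g9,
# `--supports stmt-NavierStokesRegularity-19832 --as helper`)

For `V ∈ C²` with finite weighted energy `E_w = ∫‖DV‖²‖y‖^{ρ−1}` (`ρ < 1`), the A-gauge `∫_{B_R}‖V‖² ≤ A R^{1−2ρ}` (`R ≥ 1`), a weight `g` with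
`|g| ≤ B₀`, `‖Dg‖ ≤ B₁`, `g = 0` and `Dg = 0` off `B̄(0,r)`, and `0 < q ≤ 1`, `R ≥ 1` (ball `B = B(0,(r+1)R)`, `K₁(q) = (4π/3)^{1−q}(16E_w)^q`,
exponent `x(q) = 3(1−q) + (1−ρ)q`):
* `stretch_bound_weight` — `|∫ g(R⁻¹y)‖Ω‖^{q−2}⟪DVΩ,Ω⟫| ≤ B₀·√(K₁(q)((r+1)R)^{x(q)})·√(((r+1)R)^{1−ρ}E_w)`;
* `sphere_bound_weight` — `|∫ ‖Ω‖^q·Dg(R⁻¹y)[V y]| ≤ B₁·√(K₁(q)((r+1)R)^{x(q)})·√(A((r+1)R)^{1−2ρ})`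
(Cauchy–Schwarz on `B` + `SmallMoment.smallMoment_trivial_bound` at exponent `2q ≤ 2` + `setIntegral_norm_fderiv_sq_le_of_weightedEnergy` + A);
* `trivialConst_le` — the `q`-uniform majorant `K₁(q) ≤ (4π/3)·max 1 (16E_w)` for `q ∈ [0,1]`.

HONEST FRAMING: class-free calculus about HYPOTHETICAL profiles (R53 instrument); nothing about the crux E (19832 OPEN) or NS regularity
is proved here. [nsreg-p2 R53 §2 (F1); folklore]
-/

noncomputable section

set_option linter.dupNamespace false

open Set Filter Topology Metric Function MeasureTheory InnerProductSpace
open scoped Topology ENNReal RealInnerProductSpace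

namespace Summit.NavierStokesRegularity.NavierStokesRegularity.Theorems.PowerGaugeEulerLiouville

open Literature.Analysis Literature.Analysis.FluidPDE

namespace TwoSidedMoment

variable {V : EuclideanSpace ℝ (Fin 3) → EuclideanSpace ℝ (Fin 3)} {g : EuclideanSpace ℝ (Fin 3) → ℝ}

/-- `(‖Ω‖^q)² = ‖Ω‖^{2q}`. [folklore] -/
private theorem rpow_sq_eq (a q : ℝ) (ha : 0 ≤ a) : (a ^ q) ^ 2 = a ^ (2 * q) := by
  rw [← Real.rpow_natCast _ 2, ← Real.rpow_mul ha]; push_cast; ring_nf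

/-- The stretching density is dominated by `‖Ω‖^q‖DV‖`: `|‖Ω‖^{q−2}⟪DVΩ,Ω⟫| ≤ ‖Ω‖^q·‖DV‖` (both sides vanish at `Ω = 0`, where `0^{q−2} = 0`
or the inner product vanishes). [folklore] -/
theorem abs_stretch_density_rpow_le (q : ℝ) (y : EuclideanSpace ℝ (Fin 3)) :
    |‖curl V y‖ ^ (q - 2) * ⟪fderiv ℝ V y (curl V y), curl V y⟫| ≤ ‖curl V y‖ ^ q * ‖fderiv ℝ V y‖ := by
  rcases eq_or_lt_of_le (norm_nonneg (curl V y)) with h0 | h0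
  · have hΩ0 : curl V y = 0 := norm_eq_zero.1 h0.symm
    simp only [hΩ0, map_zero, inner_zero_left, mul_zero, abs_zero, norm_zero]
    exact mul_nonneg (Real.rpow_nonneg le_rfl _) (norm_nonneg _)
  · rw [abs_mul, abs_of_nonneg (Real.rpow_nonneg (norm_nonneg _) _)]
    have hin : |⟪fderiv ℝ V y (curl V y), curl V y⟫| ≤ ‖curl V y‖ ^ 2 * ‖fderiv ℝ V y‖ := by
      calc |⟪fderiv ℝ V y (curl V y), curl V y⟫| ≤ ‖fderiv ℝ V y (curl V y)‖ * ‖curl V y‖ := abs_real_inner_le_norm _ _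
        _ ≤ ‖fderiv ℝ V y‖ * ‖curl V y‖ * ‖curl V y‖ := by gcongr; exact (fderiv ℝ V y).le_opNorm _
        _ = ‖curl V y‖ ^ 2 * ‖fderiv ℝ V y‖ := by ring
    calc ‖curl V y‖ ^ (q - 2) * |⟪fderiv ℝ V y (curl V y), curl V y⟫|
        ≤ ‖curl V y‖ ^ (q - 2) * (‖curl V y‖ ^ 2 * ‖fderiv ℝ V y‖) :=
          mul_le_mul_of_nonneg_left hin (Real.rpow_nonneg (norm_nonneg _) _)
      _ = ‖curl V y‖ ^ q * ‖fderiv ℝ V y‖ := by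
          have : ‖curl V y‖ ^ (q - 2) * ‖curl V y‖ ^ 2 = ‖curl V y‖ ^ q := by
            rw [← Real.rpow_natCast _ 2, ← Real.rpow_add h0]; push_cast; ring_nf
          rw [← mul_assoc, this]

/-- A dilated weight vanishing off `B̄(0,r)` vanishes, after dilation by `R > 0`, off the ball `B(0,(r+1)R)`. [folklore] -/
theorem dilate_eq_zero_of_not_mem_ball {F : Type*} [Zero F] {h : EuclideanSpace ℝ (Fin 3) → F} {r R : ℝ} (hR : 0 < R)
    (hh0 : ∀ x, r ≤ ‖x‖ → h x = 0) {y : EuclideanSpace ℝ (Fin 3)} (hy : y ∉ ball (0 : EuclideanSpace ℝ (Fin 3)) ((r + 1) * R)) :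
    h (R⁻¹ • y) = 0 := by
  apply hh0
  rw [mem_ball_zero_iff, not_lt] at hy
  rw [norm_smul, norm_inv, Real.norm_eq_abs, abs_of_pos hR, le_inv_mul_iff₀ hR]
  nlinarith

/-- **The stretching bound for a dilated weight** (`|g| ≤ B₀`, `g = 0` off `B̄(0,r)`, `0 < q ≤ 1`, `R ≥ 1`):
`|∫ g(R⁻¹y)‖Ω‖^{q−2}⟪DVΩ,Ω⟫| ≤ B₀·√(K₁(q)((r+1)R)^{x(q)})·√(((r+1)R)^{1−ρ}E_w)`. [nsreg-p2 R53 §2; folklore] -/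
theorem stretch_bound_weight {ρ q : ℝ} (hρ1 : ρ < 1) (hq : 0 < q) (hq1 : q ≤ 1) (hV : ContDiff ℝ 2 V)
    (hE : (∫⁻ y, ‖fderiv ℝ V y‖ₑ ^ 2 * ENNReal.ofReal (‖y‖ ^ (ρ - 1))) ≠ ⊤)
    {B₀ r : ℝ} (hB₀ : ∀ x, |g x| ≤ B₀) (hr : 0 < r) (hg0 : ∀ x, r ≤ ‖x‖ → g x = 0) {R : ℝ} (hR : 1 ≤ R) :
    |∫ y, g (R⁻¹ • y) * (‖curl V y‖ ^ (q - 2) * ⟪fderiv ℝ V y (curl V y), curl V y⟫)| ≤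
      B₀ * (Real.sqrt ((Real.pi * 4 / 3) ^ (1 - 2 * q / 2) *
          (16 * (∫⁻ y, ‖fderiv ℝ V y‖ₑ ^ 2 * ENNReal.ofReal (‖y‖ ^ (ρ - 1))).toReal) ^ (2 * q / 2) *
            ((r + 1) * R) ^ (3 * (1 - 2 * q / 2) + (1 - ρ) * (2 * q / 2))) *
        Real.sqrt (((r + 1) * R) ^ (1 - ρ) * (∫⁻ y, ‖fderiv ℝ V y‖ₑ ^ 2 * ENNReal.ofReal (‖y‖ ^ (ρ - 1))).toReal)) := by
  have hR0 : 0 < R := by linarith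
  have hrad : 0 < (r + 1) * R := by positivity
  have hB₀0 : 0 ≤ B₀ := (abs_nonneg (g 0)).trans (hB₀ 0)
  have hV1 : ContDiff ℝ 1 V := hV.of_le (by norm_cast)
  have hΩc : Continuous (curl V) := (SmallMoment.contDiff_one_curl hV).continuous
  have hDVc : Continuous (fderiv ℝ V) := hV.continuous_fderiv (by norm_cast)
  have hΩq : Continuous fun y => ‖curl V y‖ ^ q := hΩc.norm.rpow_const fun y => Or.inr hq.le
  -- pointwise domination by `B₀·1_B·‖Ω‖^q‖DV‖`
  have hptw : ∀ y, |g (R⁻¹ • y) * (‖curl V y‖ ^ (q - 2) * ⟪fderiv ℝ V y (curl V y), curl V y⟫)| ≤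
      B₀ * (ball (0 : EuclideanSpace ℝ (Fin 3)) ((r + 1) * R)).indicator (fun y => ‖curl V y‖ ^ q * ‖fderiv ℝ V y‖) y := by
    intro y
    by_cases hy : y ∈ ball (0 : EuclideanSpace ℝ (Fin 3)) ((r + 1) * R)
    · rw [indicator_of_mem hy, abs_mul]
      exact mul_le_mul (hB₀ _) (abs_stretch_density_rpow_le q y) (abs_nonneg _) hB₀0
    · rw [dilate_eq_zero_of_not_mem_ball hR0 hg0 hy, zero_mul, abs_zero, indicator_of_notMem hy, mul_zero]
  have hint : Integrable (fun y => B₀ * (ball (0 : EuclideanSpace ℝ (Fin 3)) ((r + 1) * R)).indicator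
      (fun y => ‖curl V y‖ ^ q * ‖fderiv ℝ V y‖) y) volume := by
    refine Integrable.const_mul ?_ _
    rw [integrable_indicator_iff measurableSet_ball]
    exact ((hΩq.mul hDVc.norm).continuousOn.integrableOn_compact (isCompact_closedBall _ _)).mono_set ball_subset_closedBall
  calc |∫ y, g (R⁻¹ • y) * (‖curl V y‖ ^ (q - 2) * ⟪fderiv ℝ V y (curl V y), curl V y⟫)|
      ≤ ∫ y, |g (R⁻¹ • y) * (‖curl V y‖ ^ (q - 2) * ⟪fderiv ℝ V y (curl V y), curl V y⟫)| := abs_integral_le_integral_abs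
    _ ≤ ∫ y, B₀ * (ball (0 : EuclideanSpace ℝ (Fin 3)) ((r + 1) * R)).indicator (fun y => ‖curl V y‖ ^ q * ‖fderiv ℝ V y‖) y :=
        integral_mono_of_nonneg (ae_of_all _ fun y => abs_nonneg _) hint (ae_of_all _ hptw)
    _ = B₀ * ∫ y in ball (0 : EuclideanSpace ℝ (Fin 3)) ((r + 1) * R), ‖curl V y‖ ^ q * ‖fderiv ℝ V y‖ := by
        rw [integral_const_mul, integral_indicator measurableSet_ball]
    _ ≤ B₀ * (Real.sqrt (∫ y in ball (0 : EuclideanSpace ℝ (Fin 3)) ((r + 1) * R), (‖curl V y‖ ^ q) ^ 2) *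
          Real.sqrt (∫ y in ball (0 : EuclideanSpace ℝ (Fin 3)) ((r + 1) * R), ‖fderiv ℝ V y‖ ^ 2)) := by
        gcongr
        exact SmallMoment.setIntegral_mul_le_sqrt_mul_sqrt hΩq hDVc.norm (fun y => Real.rpow_nonneg (norm_nonneg _) _)
          (fun y => norm_nonneg _) _
    _ ≤ _ := by
        have hq' : 0 < 2 * q := by linarith
        have hq'2 : 2 * q ≤ 2 := by linarith
        have h1 := SmallMoment.smallMoment_trivial_bound hρ1 hV1 hE hq' hq'2 hrad
        have h2 := SmallMoment.setIntegral_norm_fderiv_sq_le_of_weightedEnergy hρ1 hE hrad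
        have e1 : ∫ y in ball (0 : EuclideanSpace ℝ (Fin 3)) ((r + 1) * R), (‖curl V y‖ ^ q) ^ 2 =
            ∫ y in ball (0 : EuclideanSpace ℝ (Fin 3)) ((r + 1) * R), ‖curl V y‖ ^ (2 * q) :=
          integral_congr_ae (ae_of_all _ fun y => rpow_sq_eq _ _ (norm_nonneg _))
        rw [e1]
        gcongr

/-- **The sphere-flux bound for a dilated weight** (`‖Dg‖ ≤ B₁`, `Dg = 0` off `B̄(0,r)`, A-gauge, `0 < q ≤ 1`, `R ≥ 1`):
`|∫ ‖Ω‖^q·Dg(R⁻¹y)[V y]| ≤ B₁·√(K₁(q)((r+1)R)^{x(q)})·√(A((r+1)R)^{1−2ρ})`. [nsreg-p2 R53 §2; folklore] -/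
theorem sphere_bound_weight {ρ q : ℝ} (hρ1 : ρ < 1) (hq : 0 < q) (hq1 : q ≤ 1) (hV : ContDiff ℝ 2 V)
    (hE : (∫⁻ y, ‖fderiv ℝ V y‖ₑ ^ 2 * ENNReal.ofReal (‖y‖ ^ (ρ - 1))) ≠ ⊤)
    {A : ℝ} (hA : ∀ R : ℝ, 1 ≤ R → ∫ y in ball (0 : EuclideanSpace ℝ (Fin 3)) R, ‖V y‖ ^ 2 ≤ A * R ^ (1 - 2 * ρ))
    {B₁ r : ℝ} (hB₁ : ∀ x, ‖fderiv ℝ g x‖ ≤ B₁) (hr : 0 < r)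
    (hDg0 : ∀ x, r ≤ ‖x‖ → fderiv ℝ g x = 0) {R : ℝ} (hR : 1 ≤ R) :
    |∫ y, ‖curl V y‖ ^ q * fderiv ℝ g (R⁻¹ • y) (V y)| ≤
      B₁ * (Real.sqrt ((Real.pi * 4 / 3) ^ (1 - 2 * q / 2) *
          (16 * (∫⁻ y, ‖fderiv ℝ V y‖ₑ ^ 2 * ENNReal.ofReal (‖y‖ ^ (ρ - 1))).toReal) ^ (2 * q / 2) *
            ((r + 1) * R) ^ (3 * (1 - 2 * q / 2) + (1 - ρ) * (2 * q / 2))) *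
        Real.sqrt (A * ((r + 1) * R) ^ (1 - 2 * ρ))) := by
  have hR0 : 0 < R := by linarith
  have hrad : 0 < (r + 1) * R := by positivity
  have hrad1 : 1 ≤ (r + 1) * R := by nlinarith
  have hB₁0 : 0 ≤ B₁ := (norm_nonneg _).trans (hB₁ 0)
  have hV1 : ContDiff ℝ 1 V := hV.of_le (by norm_cast)
  have hVc : Continuous V := hV.continuous
  have hΩc : Continuous (curl V) := (SmallMoment.contDiff_one_curl hV).continuous
  have hΩq : Continuous fun y => ‖curl V y‖ ^ q := hΩc.norm.rpow_const fun y => Or.inr hq.le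
  have hptw : ∀ y, |‖curl V y‖ ^ q * fderiv ℝ g (R⁻¹ • y) (V y)| ≤
      B₁ * (ball (0 : EuclideanSpace ℝ (Fin 3)) ((r + 1) * R)).indicator (fun y => ‖curl V y‖ ^ q * ‖V y‖) y := by
    intro y
    by_cases hy : y ∈ ball (0 : EuclideanSpace ℝ (Fin 3)) ((r + 1) * R)
    · rw [indicator_of_mem hy, abs_mul, abs_of_nonneg (Real.rpow_nonneg (norm_nonneg _) _)]
      have h1 : |fderiv ℝ g (R⁻¹ • y) (V y)| ≤ B₁ * ‖V y‖ := by
        rw [← Real.norm_eq_abs]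
        exact ((fderiv ℝ g (R⁻¹ • y)).le_opNorm _).trans (mul_le_mul_of_nonneg_right (hB₁ _) (norm_nonneg _))
      calc ‖curl V y‖ ^ q * |fderiv ℝ g (R⁻¹ • y) (V y)| ≤ ‖curl V y‖ ^ q * (B₁ * ‖V y‖) :=
            mul_le_mul_of_nonneg_left h1 (Real.rpow_nonneg (norm_nonneg _) _)
        _ = B₁ * (‖curl V y‖ ^ q * ‖V y‖) := by ring
    · rw [dilate_eq_zero_of_not_mem_ball hR0 hDg0 hy, _root_.zero_apply, mul_zero, abs_zero,
        indicator_of_notMem hy, mul_zero]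
  have hint : Integrable (fun y => B₁ * (ball (0 : EuclideanSpace ℝ (Fin 3)) ((r + 1) * R)).indicator
      (fun y => ‖curl V y‖ ^ q * ‖V y‖) y) volume := by
    refine Integrable.const_mul ?_ _
    rw [integrable_indicator_iff measurableSet_ball]
    exact ((hΩq.mul hVc.norm).continuousOn.integrableOn_compact (isCompact_closedBall _ _)).mono_set ball_subset_closedBall
  have hA0 : 0 ≤ A := by
    have h := hA 1 le_rfl
    rw [Real.one_rpow, mul_one] at h
    exact (integral_nonneg fun y => sq_nonneg _).trans h
  calc |∫ y, ‖curl V y‖ ^ q * fderiv ℝ g (R⁻¹ • y) (V y)|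
      ≤ ∫ y, |‖curl V y‖ ^ q * fderiv ℝ g (R⁻¹ • y) (V y)| := abs_integral_le_integral_abs
    _ ≤ ∫ y, B₁ * (ball (0 : EuclideanSpace ℝ (Fin 3)) ((r + 1) * R)).indicator (fun y => ‖curl V y‖ ^ q * ‖V y‖) y :=
        integral_mono_of_nonneg (ae_of_all _ fun y => abs_nonneg _) hint (ae_of_all _ hptw)
    _ = B₁ * ∫ y in ball (0 : EuclideanSpace ℝ (Fin 3)) ((r + 1) * R), ‖curl V y‖ ^ q * ‖V y‖ := by
        rw [integral_const_mul, integral_indicator measurableSet_ball]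
    _ ≤ B₁ * (Real.sqrt (∫ y in ball (0 : EuclideanSpace ℝ (Fin 3)) ((r + 1) * R), (‖curl V y‖ ^ q) ^ 2) *
          Real.sqrt (∫ y in ball (0 : EuclideanSpace ℝ (Fin 3)) ((r + 1) * R), ‖V y‖ ^ 2)) := by
        gcongr
        exact SmallMoment.setIntegral_mul_le_sqrt_mul_sqrt hΩq hVc.norm (fun y => Real.rpow_nonneg (norm_nonneg _) _)
          (fun y => norm_nonneg _) _
    _ ≤ _ := by
        have hq' : 0 < 2 * q := by linarith
        have hq'2 : 2 * q ≤ 2 := by linarith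
        have h1 := SmallMoment.smallMoment_trivial_bound hρ1 hV1 hE hq' hq'2 hrad
        have h2 := hA ((r + 1) * R) hrad1
        have e1 : ∫ y in ball (0 : EuclideanSpace ℝ (Fin 3)) ((r + 1) * R), (‖curl V y‖ ^ q) ^ 2 =
            ∫ y in ball (0 : EuclideanSpace ℝ (Fin 3)) ((r + 1) * R), ‖curl V y‖ ^ (2 * q) :=
          integral_congr_ae (ae_of_all _ fun y => rpow_sq_eq _ _ (norm_nonneg _))
        rw [e1]
        gcongr

/-- **The `q`-uniform majorant of the trivial-bound constant**: `(4π/3)^{1−q}(16E_w)^q ≤ (4π/3)·max 1 (16E_w)` for `0 ≤ q ≤ 1`, `E_w ≥ 0`.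
[folklore] -/
theorem trivialConst_le {q Ew : ℝ} (hq0 : 0 ≤ q) (hq1 : q ≤ 1) (hEw : 0 ≤ Ew) :
    (Real.pi * 4 / 3) ^ (1 - 2 * q / 2) * (16 * Ew) ^ (2 * q / 2) ≤ (Real.pi * 4 / 3) * max 1 (16 * Ew) := by
  have hπ : 1 ≤ Real.pi * 4 / 3 := by nlinarith [Real.pi_gt_three]
  have h1 : (Real.pi * 4 / 3) ^ (1 - 2 * q / 2) ≤ (Real.pi * 4 / 3) ^ (1 : ℝ) :=
    Real.rpow_le_rpow_of_exponent_le hπ (by linarith)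
  rw [Real.rpow_one] at h1
  have h2 : (16 * Ew) ^ (2 * q / 2) ≤ max 1 (16 * Ew) := by
    rcases le_or_gt 1 (16 * Ew) with h | h
    · calc (16 * Ew) ^ (2 * q / 2) ≤ (16 * Ew) ^ (1 : ℝ) := Real.rpow_le_rpow_of_exponent_le h (by linarith)
        _ = 16 * Ew := Real.rpow_one _
        _ ≤ max 1 (16 * Ew) := le_max_right _ _
    · exact (Real.rpow_le_one (by positivity) h.le (by linarith)).trans (le_max_left _ _)
  exact mul_le_mul h1 h2 (Real.rpow_nonneg (by positivity) _) (by positivity)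

end TwoSidedMoment

end Summit.NavierStokesRegularity.NavierStokesRegularity.Theorems.PowerGaugeEulerLiouville

end
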